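import Summits.QuantumFields.YangMills.Theorems.IR.EsPolymerTorusCells

/-!
# Crux `IR` (item stmt-QuantumFields-19354) — line «es-polymer-decoupling», open engine stub `stub_polymerEngineK`,
# input (d): cell bookkeeping for an ARBITRARY grid `IsGrid N b q w` (`1 ≤ b`)

Helper module for item `stmt-QuantumFields-19354` (`--supports … --as helper`; it closes nothing; IDEATOR seat
ym-ir-idea-1 g7, RULING g9-№2, engine-level service for the lead's open provable stub `stub_polymerEngineK`).
The format `DPRk` (`Theorems/IR/EsPolymerDefsK.lean`) hands out an arbitrary grid `w` of mesh `b`, `q` cells per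
direction, on the torus of side `N = 2S+1`, and its clauses (I)_k (D)_k read observables through
`DependsOn · (blockEdges N q w c k)`.  To feed a species (a cylinder function of finitely many `ℤ⁴`-edges, lifted
periodically to the torus and translated) into them: §1 the cell index `idx w t` of an integer in a one-dimensional
grid (existence/uniqueness, `idx 0 = 0`, monotone, `1`-Lipschitz, period `idx (t + N m) = idx t + q m`, mesh bounds
`t < 2b (idx t + 1)`, `idx t < q`, `N - t ≤ 2b (q - idx t)` on `0 ≤ t < N`); §2 the cell `cellOf q w y : Cell q` of a
site `y : ℤ⁴` (via the cell torus `(ℤ/q)⁴`, `cellEquiv`): every torus edge `torusEdge N (y, i)` lies in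
`torusCellEdges N q w (cellOf q w y)`, sites at sup-distance `≤ R` have cells at cell distance `≤ R`, and the cells of
`0` and `n • e₀`, `n ≤ S`, satisfy `n + 1 ≤ 2b (cellDist + 1)`; §3 a cylinder observable of support sup-radius `≤ R`,
lifted and translated by `v`, `DependsOn` the radius-`R` block about `cellOf q w v`.  Pure lattice geometry.
HONEST FRAMING: bookkeeping for an OPEN, PROVABLE engine stub of a CONDITIONAL rung line; the load `stub_polymerCertK`
(XL) is untouched; nothing here proves `BalabanLadder.IR`, a mass gap, or the Clay problem; R4 = `BalabanLadder.UV` only.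
-/

set_option autoImplicit false

noncomputable section

open Finset Function
open Literature.MathematicalPhysics.QuantumFieldTheory
open Literature.MathematicalPhysics.QuantumLattice (LGConfig torusEdge torusLift configShift configShift_apply IsCylinder)
open Literature.Probability.LatticeModels (Torus.proj Torus.proj_apply Site.supNorm Site.natAbs_le_supNorm)
open Summit.QuantumFields.YangMills.Cruxes.IR.Tempered (cellEdges)

namespace Summit.QuantumFields.YangMills.Cruxes.IR.EsPolymer.GridCells

/-! ## §1 One-dimensional grids: the cell index of an integer -/

section OneDim

variable {w : ℤ → ℤ} {N q b : ℕ}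

/-- Cells have length at least one: `w j + s ≤ w (j + s)`. -/
theorem add_le_grid (hstep : ∀ j, w j + 1 ≤ w (j + 1)) (j : ℤ) (s : ℕ) : w j + s ≤ w (j + s) := by
  induction s with
  | zero => simp
  | succ s ih =>
    have h := hstep (j + s)
    have e : j + ((s + 1 : ℕ) : ℤ) = j + s + 1 := by push_cast; ring
    rw [e]; push_cast; linarith

/-- Cells have length at most `2b`: `w (j + s) ≤ w j + 2 b s`. -/
theorem grid_add_le (hup : ∀ j, w (j + 1) ≤ w j + 2 * (b : ℤ)) (j : ℤ) (s : ℕ) :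
    w (j + s) ≤ w j + 2 * (b : ℤ) * s := by
  induction s with
  | zero => simp
  | succ s ih =>
    have h := hup (j + s)
    have e : j + ((s + 1 : ℕ) : ℤ) = j + s + 1 := by push_cast; ring
    rw [e]; push_cast; linarith

/-- The grid is monotone. -/
theorem grid_mono (hstep : ∀ j, w j + 1 ≤ w (j + 1)) {j j' : ℤ} (h : j ≤ j') : w j ≤ w j' := by
  obtain ⟨n, rfl⟩ := Int.le.dest h
  have := add_le_grid hstep j n
  linarith

/-- Period: `w (j + q m) = w j + N m` for every integer `m`. -/
theorem grid_add_mul (hper : ∀ j, w (j + q) = w j + N) (j m : ℤ) : w (j + q * m) = w j + N * m := by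
  induction m using Int.induction_on with
  | zero => simp
  | succ i ih =>
    have e : j + q * ((i : ℤ) + 1) = j + q * i + q := by ring
    rw [e, hper, ih]; ring
  | pred i ih =>
    have e : j + q * (-(i : ℤ)) = j + q * (-(i : ℤ) - 1) + q := by ring
    rw [e, hper] at ih
    linarith

/-- Every integer lies in a cell. -/
theorem exists_idx (hw0 : w 0 = 0) (hstep : ∀ j, w j + 1 ≤ w (j + 1)) (t : ℤ) :
    ∃ j, w j ≤ t ∧ t < w (j + 1) := by
  classical
  have hbd : ∃ B : ℤ, ∀ z, w z ≤ t → z ≤ B := by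
    refine ⟨(t.natAbs : ℤ), fun z hz => ?_⟩
    by_contra h
    have h0 : (0 : ℤ) ≤ z := by omega
    obtain ⟨n, hn⟩ := Int.le.dest h0
    have h1 := add_le_grid hstep 0 n
    rw [hw0, hn] at h1
    omega
  have hex : ∃ z, w z ≤ t := by
    refine ⟨-(t.natAbs : ℤ), ?_⟩
    have h1 := add_le_grid hstep (-(t.natAbs : ℤ)) t.natAbs
    rw [neg_add_cancel, hw0] at h1
    omega
  obtain ⟨j, hj, hmax⟩ := Int.exists_greatest_of_bdd hbd hex
  refine ⟨j, hj, ?_⟩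
  by_contra h
  have := hmax (j + 1) (not_lt.1 h)
  omega

open Classical in
/-- The index of the cell `[w j, w (j+1))` containing `t` (junk `0` if there is none). -/
def idx (w : ℤ → ℤ) (t : ℤ) : ℤ :=
  if h : ∃ j, w j ≤ t ∧ t < w (j + 1) then h.choose else 0

/-- Defining property of the index. -/
theorem idx_spec (hw0 : w 0 = 0) (hstep : ∀ j, w j + 1 ≤ w (j + 1)) (t : ℤ) :
    w (idx w t) ≤ t ∧ t < w (idx w t + 1) := by
  have h := exists_idx hw0 hstep t
  rw [idx, dif_pos h]; exact h.choose_spec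

/-- Uniqueness of the index. -/
theorem idx_eq (hw0 : w 0 = 0) (hstep : ∀ j, w j + 1 ≤ w (j + 1)) {t j : ℤ} (h1 : w j ≤ t)
    (h2 : t < w (j + 1)) : idx w t = j := by
  obtain ⟨h1', h2'⟩ := idx_spec hw0 hstep t
  by_contra hne
  rcases lt_or_gt_of_ne hne with h | h
  · have := grid_mono hstep (show idx w t + 1 ≤ j by omega); omega
  · have := grid_mono hstep (show j + 1 ≤ idx w t by omega); omega

/-- The origin lies in cell `0`. -/
theorem idx_zero (hw0 : w 0 = 0) (hstep : ∀ j, w j + 1 ≤ w (j + 1)) : idx w 0 = 0 :=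
  idx_eq hw0 hstep (by rw [hw0]) (by have := hstep 0; rw [hw0] at this; simp only [zero_add] at this ⊢; omega)

/-- The index is monotone. -/
theorem idx_mono (hw0 : w 0 = 0) (hstep : ∀ j, w j + 1 ≤ w (j + 1)) {t t' : ℤ} (h : t ≤ t') :
    idx w t ≤ idx w t' := by
  by_contra hlt
  have s1 := idx_spec hw0 hstep t; have s2 := idx_spec hw0 hstep t'
  have := grid_mono hstep (show idx w t' + 1 ≤ idx w t by omega); omega

/-- The index is `1`-Lipschitz (cells have length `≥ 1`). -/
theorem idx_sub_le (hw0 : w 0 = 0) (hstep : ∀ j, w j + 1 ≤ w (j + 1)) {t t' : ℤ} (h : t ≤ t') :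
    idx w t' - idx w t ≤ t' - t := by
  by_contra hc
  have s1 := idx_spec hw0 hstep t; have s2 := idx_spec hw0 hstep t'
  obtain ⟨n, hn⟩ := Int.le.dest h
  have h1 := add_le_grid hstep (idx w t + 1) n
  have h2 := grid_mono hstep (show idx w t + 1 + n ≤ idx w t' by omega); omega

/-- `|idx t' - idx t| ≤ |t' - t|`. -/
theorem abs_idx_sub_idx_le (hw0 : w 0 = 0) (hstep : ∀ j, w j + 1 ≤ w (j + 1)) (t t' : ℤ) :
    |idx w t' - idx w t| ≤ |t' - t| := by
  rcases le_total t t' with h | h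
  · rw [abs_of_nonneg (sub_nonneg.2 (idx_mono hw0 hstep h)), abs_of_nonneg (sub_nonneg.2 h)]
    exact idx_sub_le hw0 hstep h
  · rw [abs_sub_comm, abs_sub_comm t', abs_of_nonneg (sub_nonneg.2 (idx_mono hw0 hstep h)),
      abs_of_nonneg (sub_nonneg.2 h)]
    exact idx_sub_le hw0 hstep h

/-- Period of the index: `idx (t + N m) = idx t + q m`. -/
theorem idx_add_mul (hw0 : w 0 = 0) (hstep : ∀ j, w j + 1 ≤ w (j + 1)) (hper : ∀ j, w (j + q) = w j + N)
    (t m : ℤ) : idx w (t + N * m) = idx w t + q * m := by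
  have s := idx_spec hw0 hstep t
  refine idx_eq hw0 hstep ?_ ?_
  · rw [grid_add_mul hper]; linarith
  · have e : idx w t + q * m + 1 = idx w t + 1 + q * m := by ring
    rw [e, grid_add_mul hper]; linarith

/-- Nonnegative integers have nonnegative index. -/
theorem idx_nonneg (hw0 : w 0 = 0) (hstep : ∀ j, w j + 1 ≤ w (j + 1)) {t : ℤ} (ht : 0 ≤ t) : 0 ≤ idx w t := by
  have := idx_mono hw0 hstep ht; rwa [idx_zero hw0 hstep] at this

/-- Mesh bound: `t < 2b (idx t + 1)` for `t ≥ 0`. -/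
theorem lt_mul_idx_add_one (hw0 : w 0 = 0) (hstep : ∀ j, w j + 1 ≤ w (j + 1))
    (hup : ∀ j, w (j + 1) ≤ w j + 2 * (b : ℤ)) {t : ℤ} (ht : 0 ≤ t) : t < 2 * (b : ℤ) * (idx w t + 1) := by
  have s := idx_spec hw0 hstep t
  have h0 := idx_nonneg hw0 hstep ht
  obtain ⟨n, hn⟩ := Int.le.dest (show (0 : ℤ) ≤ idx w t + 1 by omega)
  have h1 := grid_add_le hup 0 n
  rw [hw0, hn] at h1
  have hn' : (n : ℤ) = idx w t + 1 := by omega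
  rw [hn'] at h1
  omega

/-- Below the period the index is below `q`. -/
theorem idx_lt (hw0 : w 0 = 0) (hstep : ∀ j, w j + 1 ≤ w (j + 1)) (hper : ∀ j, w (j + q) = w j + N) {t : ℤ}
    (ht : t < N) : idx w t < q := by
  by_contra h
  have s := idx_spec hw0 hstep t
  have h1 := grid_mono hstep (not_lt.1 h)
  have hq : w q = N := by have := hper 0; rwa [zero_add, hw0, zero_add] at this
  omega

/-- Mesh bound from above: `N - t ≤ 2b (q - idx t)` for `t < N`. -/
theorem sub_le_mul_sub_idx (hw0 : w 0 = 0) (hstep : ∀ j, w j + 1 ≤ w (j + 1))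
    (hup : ∀ j, w (j + 1) ≤ w j + 2 * (b : ℤ)) (hper : ∀ j, w (j + q) = w j + N) {t : ℤ} (ht : t < N) :
    (N : ℤ) - t ≤ 2 * (b : ℤ) * (q - idx w t) := by
  have hlt := idx_lt hw0 hstep hper ht; have s := idx_spec hw0 hstep t
  obtain ⟨n, hn⟩ := Int.le.dest hlt.le
  have h1 := grid_add_le hup (idx w t) n
  have hq : w q = N := by have := hper 0; rwa [zero_add, hw0, zero_add] at this
  rw [hn, hq] at h1
  have hn' : (n : ℤ) = q - idx w t := by omega
  rw [hn'] at h1; linarith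

end OneDim

/-! ## §2 Cells of lattice sites for a grid `IsGrid N b q w` with `1 ≤ b` -/

section Grid4

variable {N b q : ℕ} {w : Fin 4 → ℤ → ℤ}
/-- Accessor: origin. -/
theorem grid_zero (hg : IsGrid N b q w) (i : Fin 4) : w i 0 = 0 := hg.2.1 i
/-- Accessor: cells have length `≥ b ≥ 1`. -/
theorem grid_step (hg : IsGrid N b q w) (hb : 1 ≤ b) (i : Fin 4) (j : ℤ) : w i j + 1 ≤ w i (j + 1) := by
  have h := (hg.2.2.1 i j).1
  have : (1 : ℤ) ≤ b := by exact_mod_cast hb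
  omega
/-- Accessor: cells have length `≤ 2b`. -/
theorem grid_up (hg : IsGrid N b q w) (i : Fin 4) (j : ℤ) : w i (j + 1) ≤ w i j + 2 * (b : ℤ) :=
  (hg.2.2.1 i j).2
/-- Accessor: period. -/
theorem grid_per (hg : IsGrid N b q w) (i : Fin 4) (j : ℤ) : w i (j + q) = w i j + N := hg.2.2.2 i j

/-- The integer cell-index vector of a lattice site. -/
def idxVec (w : Fin 4 → ℤ → ℤ) (y : Fin 4 → ℤ) : Fin 4 → ℤ := fun i => idx (w i) (y i)

/-- The index vector of the origin is `0`. -/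
theorem idxVec_zero (hg : IsGrid N b q w) (hb : 1 ≤ b) : idxVec w 0 = 0 := by
  funext i; exact idx_zero (grid_zero hg i) (grid_step hg hb i)

variable [NeZero q]

/-- The cell (of the cell torus `(ℤ/q)⁴`) containing the lattice site `y`. -/
def cellOf (q : ℕ) [NeZero q] (w : Fin 4 → ℤ → ℤ) (y : Fin 4 → ℤ) : Cell q :=
  cellEquiv.symm (Torus.proj q (idxVec w y))

/-- `cellEquiv (cellOf q w y) = Torus.proj q (idxVec w y)`. -/
theorem cellEquiv_cellOf (y : Fin 4 → ℤ) : cellEquiv (cellOf q w y) = Torus.proj q (idxVec w y) :=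
  Equiv.apply_symm_apply _ _

/-- The canonical index `(c i).val ∈ [0, q)` of the cell of `y` is congruent to `idx (w i) (y i)` mod `q`. -/
theorem dvd_idx_sub_val (y : Fin 4 → ℤ) (i : Fin 4) :
    (q : ℤ) ∣ idxVec w y i - ((cellOf q w y i : ℕ) : ℤ) := by
  have h := natCast_val_eq_cellEquiv (cellOf q w y) i
  rw [cellEquiv_cellOf, Torus.proj_apply] at h
  have h' : ((((cellOf q w y i : ℕ) : ℤ)) : ZMod q) = ((idxVec w y i : ℤ) : ZMod q) := by
    rw [Int.cast_natCast]; exact h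
  exact (ZMod.intCast_eq_intCast_iff_dvd_sub _ _ _).1 h'

/-- **Every torus edge lies in the cell of its base site.** -/
theorem torusEdge_mem_torusCellEdges (hg : IsGrid N b q w) (hb : 1 ≤ b) (y : Fin 4 → ℤ) (i : Fin 4) :
    torusEdge N (y, i) ∈ torusCellEdges N q w (cellOf q w y) := by
  classical
  -- the multiples of `q` separating the true index from the canonical one
  have hm : ∀ j : Fin 4, ∃ m : ℤ, idxVec w y j - ((cellOf q w y j : ℕ) : ℤ) = q * m :=
    fun j => dvd_idx_sub_val y j
  choose m hm using hm
  rw [torusCellEdges, Finset.mem_image]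
  refine ⟨(fun j => y j - N * m j, i), ?_, ?_⟩
  · simp only [cellEdges, Finset.mem_product, Fintype.mem_piFinset, Finset.mem_Ico, Finset.mem_univ, and_true]
    intro j
    have s := idx_spec (grid_zero hg j) (grid_step hg hb j) (y j)
    have hc : ((cellOf q w y j : ℕ) : ℤ) = idxVec w y j + q * (-m j) := by have := hm j; linarith
    have h1 : w j ((cellOf q w y j : ℕ) : ℤ) = w j (idxVec w y j) + N * (-m j) := by
      rw [hc, grid_add_mul (grid_per hg j)]
    have h2 : w j (((cellOf q w y j : ℕ) : ℤ) + 1) = w j (idxVec w y j + 1) + N * (-m j) := by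
      rw [hc, show idxVec w y j + q * -m j + 1 = idxVec w y j + 1 + q * -m j by ring,
        grid_add_mul (grid_per hg j)]
    simp only [idxVec] at h1 h2 s ⊢
    constructor
    · rw [h1]; linarith
    · rw [h2]; linarith
  · simp only [torusEdge, Prod.mk.injEq, and_true]
    funext j
    simp only [Torus.proj_apply]
    push_cast
    simp

/-- Sites at sup-distance `≤ R` lie in cells at cell distance `≤ R`. -/
theorem cellDist_cellOf_le (hg : IsGrid N b q w) (hb : 1 ≤ b) (y y' : Fin 4 → ℤ) {R : ℕ}
    (h : ∀ i, |y' i - y i| ≤ R) : cellDist (cellOf q w y) (cellOf q w y') ≤ R := by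
  rw [cellDist_eq_torusNorm, cellEquiv_cellOf, cellEquiv_cellOf]
  have e : Torus.proj q (idxVec w y) - Torus.proj q (idxVec w y') = Torus.proj q (idxVec w y - idxVec w y') := by
    funext i; simp [Torus.proj_apply]
  rw [e]
  refine (torusNorm_proj_le _).trans (Finset.sup_le fun i _ => ?_)
  have key : |idxVec w y i - idxVec w y' i| ≤ (R : ℤ) := by
    rw [abs_sub_comm]
    exact (abs_idx_sub_idx_le (grid_zero hg i) (grid_step hg hb i) (y i) (y' i)).trans (h i)
  have : (((idxVec w y - idxVec w y') i).natAbs : ℤ) ≤ R := by rw [Int.natCast_natAbs]; exact key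
  exact_mod_cast this

/-- **Mesh bound for the time-translated cell.**  For `n ≤ S` on the torus of side `N = 2S+1`, the cells of `0`
and of `n • e₀` satisfy `n + 1 ≤ 2b (cellDist + 1)` (both ways round the torus). -/
theorem succ_le_mul_cellDist (hg : IsGrid (2 * N + 1) b q w) (hb : 1 ≤ b) {n : ℕ} (hn : n ≤ N) :
    (n : ℤ) + 1 ≤ 2 * (b : ℤ) * (cellDist (cellOf q w 0) (cellOf q w (Pi.single 0 (n : ℤ))) + 1) := by
  set J : ℤ := idx (w 0) n with hJ
  have hw0 := grid_zero hg 0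
  have hst := grid_step hg hb 0
  have hJ0 : 0 ≤ J := idx_nonneg hw0 hst (by positivity)
  have hJq : J < q := idx_lt hw0 hst (grid_per hg 0) (by push_cast; omega)
  have hlow : (n : ℤ) < 2 * (b : ℤ) * (J + 1) := lt_mul_idx_add_one hw0 hst (grid_up hg 0) (by positivity)
  have hhigh : ((2 * N + 1 : ℕ) : ℤ) - n ≤ 2 * (b : ℤ) * (q - J) :=
    sub_le_mul_sub_idx hw0 hst (grid_up hg 0) (grid_per hg 0) (by push_cast; omega)
  -- the index vector of `n • e₀` is `J • e₀`
  have hvec : idxVec w (Pi.single 0 (n : ℤ)) = Pi.single 0 J := by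
    funext i
    by_cases hi : i = 0
    · subst hi; simp [idxVec, hJ]
    · simp [idxVec, Pi.single_eq_of_ne hi, idx_zero (grid_zero hg i) (grid_step hg hb i)]
  -- the cell distance dominates the cyclic distance of `J` from `0` in `ℤ/q`
  have hdist : min ((J : ZMod q).val) (q - (J : ZMod q).val) ≤
      cellDist (cellOf q w 0) (cellOf q w (Pi.single 0 (n : ℤ))) := by
    rw [cellDist_eq_torusNorm, cellEquiv_cellOf, cellEquiv_cellOf, idxVec_zero hg hb, hvec]
    have e : Torus.proj q (0 : Fin 4 → ℤ) - Torus.proj q (Pi.single 0 J) = -Torus.proj q (Pi.single 0 J) := by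
      funext i; simp [Torus.proj_apply]
    rw [e, torusNorm_neg, ← ZMod.valMinAbs_natAbs_eq_min]
    have h0 : (Torus.proj q (Pi.single (0 : Fin 4) J)) 0 = (J : ZMod q) := by simp [Torus.proj_apply]
    rw [← h0]
    exact Finset.le_sup (f := fun i => ((Torus.proj q (Pi.single (0 : Fin 4) J) i).valMinAbs).natAbs)
      (Finset.mem_univ 0)
  have hval : (((J : ZMod q).val : ℕ) : ℤ) = J := by
    rw [ZMod.val_intCast, Int.emod_eq_of_lt hJ0 hJq]
  -- case analysis on which way round the torus is shorter
  set v : ℕ := (J : ZMod q).val with hv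
  have hvq : v ≤ q := (ZMod.val_lt _).le
  have hb0 : (0 : ℤ) ≤ 2 * (b : ℤ) := by positivity
  rcases le_total v (q - v) with hle | hle
  · rw [min_eq_left hle] at hdist
    have : (J : ℤ) + 1 ≤ cellDist (cellOf q w 0) (cellOf q w (Pi.single 0 (n : ℤ))) + 1 := by
      have : (v : ℤ) ≤ cellDist (cellOf q w 0) (cellOf q w (Pi.single 0 (n : ℤ))) := by exact_mod_cast hdist
      linarith
    calc (n : ℤ) + 1 ≤ 2 * (b : ℤ) * (J + 1) := by omega
      _ ≤ _ := mul_le_mul_of_nonneg_left this hb0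
  · rw [min_eq_right hle] at hdist
    have h1 : ((q : ℤ) - J) ≤ cellDist (cellOf q w 0) (cellOf q w (Pi.single 0 (n : ℤ))) + 1 := by
      have : ((q - v : ℕ) : ℤ) ≤ cellDist (cellOf q w 0) (cellOf q w (Pi.single 0 (n : ℤ))) := by
        exact_mod_cast hdist
      push_cast [hvq] at this
      linarith
    calc (n : ℤ) + 1 ≤ ((2 * N + 1 : ℕ) : ℤ) - n := by push_cast; omega
      _ ≤ 2 * (b : ℤ) * (q - J) := hhigh
      _ ≤ _ := mul_le_mul_of_nonneg_left h1 hb0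

end Grid4

/-! ## §3 Cylinder observables on the torus depend on the block of their support -/

section Support

variable {G : Type} [MeasurableSpace G] {N b q : ℕ} {w : Fin 4 → ℤ → ℤ} [NeZero q]

/-- The sup-radius of a finite edge set of `ℤ⁴` (base sites). -/
def suppRadius (A : Finset (Literature.MathematicalPhysics.QuantumLattice.ZdEdge 4)) : ℕ := A.sup fun e => Site.supNorm e.1

/-- Coordinates of support sites are bounded by the sup-radius. -/
theorem abs_le_suppRadius {A : Finset (Literature.MathematicalPhysics.QuantumLattice.ZdEdge 4)} {e : Literature.MathematicalPhysics.QuantumLattice.ZdEdge 4} (he : e ∈ A) (i : Fin 4) :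
    |e.1 i| ≤ (suppRadius A : ℤ) := by
  have h1 : (e.1 i).natAbs ≤ suppRadius A :=
    (Site.natAbs_le_supNorm e.1 i).trans (Finset.le_sup (f := fun e : Literature.MathematicalPhysics.QuantumLattice.ZdEdge 4 => Site.supNorm e.1) he)
  rw [Int.abs_eq_natAbs]; exact_mod_cast h1

/-- The translate by `v` of a support edge lies in a cell within the sup-radius of the cell of `v`. -/
theorem cellDist_cellOf_add_le (hg : IsGrid N b q w) (hb : 1 ≤ b) {A : Finset (Literature.MathematicalPhysics.QuantumLattice.ZdEdge 4)} {R : ℕ}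
    (hR : suppRadius A ≤ R) {e : Literature.MathematicalPhysics.QuantumLattice.ZdEdge 4} (he : e ∈ A) (v : Fin 4 → ℤ) :
    cellDist (cellOf q w v) (cellOf q w (e.1 + v)) ≤ R := by
  refine cellDist_cellOf_le hg hb v (e.1 + v) fun i => ?_
  have : (e.1 + v) i - v i = e.1 i := by simp only [Pi.add_apply]; ring
  rw [this]
  exact (abs_le_suppRadius he i).trans (by exact_mod_cast hR)

/-- **A cylinder observable, lifted to the torus and translated by `v`, depends on the block of radius `R ≥` its
support's sup-radius about the cell of `v`.** -/
theorem dependsOn_blockEdges_shift (hg : IsGrid N b q w) (hb : 1 ≤ b) {F : LGConfig 4 G → ℝ}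
    {A : Finset (Literature.MathematicalPhysics.QuantumLattice.ZdEdge 4)} (hF : IsCylinder F A) {R : ℕ} (hR : suppRadius A ≤ R) (v : Fin 4 → ℤ) :
    DependsOn (fun U : GaugeConfig 4 N G => F (configShift (-v) (torusLift N U))) (blockEdges N q w (cellOf q w v) R) := by
  intro U V hUV
  apply hF
  intro e he
  rw [configShift_apply, configShift_apply, sub_neg_eq_add]
  have hmem : torusEdge N (e.1 + v, e.2) ∈ blockEdges N q w (cellOf q w v) R := by
    simp only [blockEdges, Set.mem_setOf_eq]
    exact ⟨cellOf q w (e.1 + v), cellDist_cellOf_add_le hg hb hR he v, torusEdge_mem_torusCellEdges hg hb _ _⟩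
  exact hUV _ hmem

omit [MeasurableSpace G] in
/-- **The untranslated case: the block about the cell of the origin.** -/
theorem dependsOn_blockEdges (hg : IsGrid N b q w) (hb : 1 ≤ b) {F : LGConfig 4 G → ℝ}
    {A : Finset (Literature.MathematicalPhysics.QuantumLattice.ZdEdge 4)} (hF : IsCylinder F A) {R : ℕ} (hR : suppRadius A ≤ R) :
    DependsOn (fun U : GaugeConfig 4 N G => F (torusLift N U)) (blockEdges N q w (cellOf q w 0) R) := by
  intro U V hUV
  apply hF
  intro e he
  have hmem : torusEdge N e ∈ blockEdges N q w (cellOf q w 0) R := by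
    simp only [blockEdges, Set.mem_setOf_eq]
    have h := cellDist_cellOf_add_le hg hb hR he (0 : Fin 4 → ℤ)
    rw [add_zero] at h
    exact ⟨cellOf q w e.1, h, torusEdge_mem_torusCellEdges hg hb e.1 e.2⟩
  exact hUV _ hmem

end Support

end Summit.QuantumFields.YangMills.Cruxes.IR.EsPolymer.GridCells

end
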